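import Literature.NumberTheory.LFunctions.KadiriStripEmptiness
import HarnessLib

/-!
# The numerical condition (N1) of `KadiriStrip.strip_empty`, rearranged for certification

Topic `Literature/NumberTheory/LFunctions`. Everything in this file is PROVED; the three
definitions are abbreviations. The quantity bounded in (N1),
`coeffQ0 + λ₀ r² log(K+1)/R + coeffQ1·η₀ + coeffQ2·η₀²`, is linear in the coefficients `b_k` of the
trigonometric polynomial and, for `k ≥ 1`, affine in `log(k+1)`:

  `N1 = n1Head + Σ_{k<K} b_{k+1} (n1Alpha + n1Beta · log(k+1))`      (`n1_rearrange`),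

with `n1Head`, `n1Alpha`, `n1Beta` explicit in the constants of the method. This is the form in
which the tree certifies (N1) round by round (bounding `n1Head`, `n1Alpha`, `n1Beta` once per round
by interval arithmetic and composing).

## References

* M. J. Mossinghoff, T. S. Trudgian, J. Number Theory 157 (2015), (2.2) and §4.
  (`MossinghoffTrudgian2015`)
-/

noncomputable section

open Real

namespace Literature.NumberTheory.LFunctions

namespace KadiriStrip

/-- The coefficient of `log(k+1)` in the `k`-th summand of (N1). [cite: MossinghoffTrudgian2015, §4] -/
def n1Beta (θ κ σ₀ η₀ t₀ Mst m : ℝ) : ℝ :=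
  fordSmoothW0 θ * ((1 - κ) / 2) + η₀ * ((1 + κ) * Mst * (3 * (30 * (1 / t₀ ^ 2 + 1 / t₀)))) +
    η₀ ^ 2 * ((1 + κ) * m * (π / (σ₀ - 1 / 2) / (2 * π * (σ₀ - 1 / 2))))

/-- The `log(k+1)`-free part of the `k`-th summand of (N1). [cite: MossinghoffTrudgian2015, §4] -/
def n1Alpha (θ r κ σ₀ η₀ T₀ t₀ Mst m : ℝ) : ℝ :=
  fordSmoothW0 θ * ((1 - κ) / 2 * (-Real.log (2 * π)) + 5 / T₀ ^ 2) + (1 + κ) * fordSmoothW0 θ / T₀ ^ 2 +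
      (1 + κ) * Mst * 90 * (1 / t₀ ^ 2 + 1 / t₀) / r +
    η₀ * ((1 + κ) * Mst / T₀ ^ 2 + (1 + κ) * m * (π / (σ₀ - 1 / 2)) / (2 * π * (σ₀ - 1 / 2) * r) +
      (1 + κ) * Mst * (3 * ((154 + 30 * 1) * (1 / t₀ ^ 2 + 1 / t₀) +
        30 * (Real.log t₀ / t₀ ^ 2 + (Real.log t₀ + 1) / t₀)))) +
    η₀ ^ 2 * ((1 + κ) * m * (2 / T₀ ^ 2 +
      (π / (σ₀ - 1 / 2) * (12 + Real.log 2) + (4 / (σ₀ - 1 / 2) ^ 2 + 8)) / (2 * π * (σ₀ - 1 / 2))))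

/-- The `b_{k≥2}`-free part of (N1) (it involves `b₁` through the kept pair at `k = 1`).
[cite: MossinghoffTrudgian2015, §4] -/
def n1Head (θ : ℝ) (K : ℕ) (r R δ κ σ₀ η₀ t₀ Mst m lam0 b1 : ℝ) : ℝ :=
  -b1 * fordSmoothW0 θ + κ * b1 * fordSmoothW0 θ * (1 / δ + 1 / (σ₀ + δ - η₀)) -
        κ * 1 * fordSmoothW0 θ / δ +
      1 * fordSmoothW0 θ * (-((1 - κ) / 2) * Real.log π + (Complex.digamma ((3 / 2 : ℝ) : ℂ)).re / 2 -
        κ / 2 * (Complex.digamma ((((σ₀ + δ) / 2 + 1 : ℝ)) : ℂ)).re) +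
    lam0 * (r ^ 2 * Real.log ((K : ℝ) + 1) / R) +
    (1 * ((1 + κ) * Mst * (3 * KadiriTail.tailBound 0 t₀))) * η₀ +
    (b1 * m + κ * b1 * m * (1 / δ ^ 3 + 1 / (σ₀ + δ - η₀) ^ 3) + κ * 1 * m / (σ₀ + δ - 1) ^ 3 +
      1 * ((1 + κ) * m * (1 / σ₀ ^ 3 + (π / (σ₀ - 1 / 2) * (Real.log 3 + 12) +
        (4 / (σ₀ - 1 / 2) ^ 2 + 8)) / (2 * π * (σ₀ - 1 / 2))))) * η₀ ^ 2

/-- **(N1) rearranged**: for `b₀ = 1`,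
`coeffQ0 + λ₀ r² log(K+1)/R + coeffQ1·η₀ + coeffQ2·η₀² = n1Head + Σ_{k<K} b_{k+1}(n1Alpha + n1Beta·log(k+1))`.
[cite: MossinghoffTrudgian2015, (2.2) and §4] -/
theorem n1_rearrange (θ : ℝ) (K : ℕ) (b : ℕ → ℝ) (hb0 : b 0 = 1)
    (r R δ κ σ₀ η₀ T₀ t₀ Mst m lam0 : ℝ) :
    coeffQ0 θ K b r δ κ σ₀ η₀ T₀ t₀ Mst + lam0 * (r ^ 2 * Real.log ((K : ℝ) + 1) / R) +
        coeffQ1 K b r κ σ₀ T₀ t₀ Mst m * η₀ + coeffQ2 K b δ κ σ₀ η₀ T₀ m * η₀ ^ 2 =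
      n1Head θ K r R δ κ σ₀ η₀ t₀ Mst m lam0 (b 1) +
        ∑ k ∈ Finset.range K, b (k + 1) *
          (n1Alpha θ r κ σ₀ η₀ T₀ t₀ Mst m + n1Beta θ κ σ₀ η₀ t₀ Mst m * Real.log ((k + 1 : ℕ) : ℝ)) := by
  unfold coeffQ0 coeffQ1 coeffQ2 n1Head n1Alpha n1Beta
  rw [hb0]
  -- collect the three sums
  have key : ∀ k : ℕ,
      b (k + 1) * (fordSmoothW0 θ * ((1 - κ) / 2 * (Real.log ((k + 1 : ℕ) : ℝ) - Real.log (2 * π)) + 5 / T₀ ^ 2) +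
          (1 + κ) * fordSmoothW0 θ / T₀ ^ 2 + (1 + κ) * Mst * 90 * (1 / t₀ ^ 2 + 1 / t₀) / r) +
        b (k + 1) * ((1 + κ) * Mst / T₀ ^ 2 + (1 + κ) * m * (π / (σ₀ - 1 / 2)) / (2 * π * (σ₀ - 1 / 2) * r) +
          (1 + κ) * Mst * (3 * ((154 + 30 * (Real.log ((k + 1 : ℕ) : ℝ) + 1)) * (1 / t₀ ^ 2 + 1 / t₀) +
            30 * (Real.log t₀ / t₀ ^ 2 + (Real.log t₀ + 1) / t₀)))) * η₀ +
        b (k + 1) * ((1 + κ) * m * (2 / T₀ ^ 2 +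
          (π / (σ₀ - 1 / 2) * Real.log ((k + 1 : ℕ) : ℝ) +
            (π / (σ₀ - 1 / 2) * (12 + Real.log 2) + (4 / (σ₀ - 1 / 2) ^ 2 + 8))) / (2 * π * (σ₀ - 1 / 2)))) * η₀ ^ 2 =
      b (k + 1) * ((fordSmoothW0 θ * ((1 - κ) / 2 * (-Real.log (2 * π)) + 5 / T₀ ^ 2) +
          (1 + κ) * fordSmoothW0 θ / T₀ ^ 2 + (1 + κ) * Mst * 90 * (1 / t₀ ^ 2 + 1 / t₀) / r +
        η₀ * ((1 + κ) * Mst / T₀ ^ 2 + (1 + κ) * m * (π / (σ₀ - 1 / 2)) / (2 * π * (σ₀ - 1 / 2) * r) +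
          (1 + κ) * Mst * (3 * ((154 + 30 * 1) * (1 / t₀ ^ 2 + 1 / t₀) +
            30 * (Real.log t₀ / t₀ ^ 2 + (Real.log t₀ + 1) / t₀)))) +
        η₀ ^ 2 * ((1 + κ) * m * (2 / T₀ ^ 2 +
          (π / (σ₀ - 1 / 2) * (12 + Real.log 2) + (4 / (σ₀ - 1 / 2) ^ 2 + 8)) / (2 * π * (σ₀ - 1 / 2))))) +
        (fordSmoothW0 θ * ((1 - κ) / 2) + η₀ * ((1 + κ) * Mst * (3 * (30 * (1 / t₀ ^ 2 + 1 / t₀)))) +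
          η₀ ^ 2 * ((1 + κ) * m * (π / (σ₀ - 1 / 2) / (2 * π * (σ₀ - 1 / 2))))) * Real.log ((k + 1 : ℕ) : ℝ)) := by
    intro k; ring
  rw [← Finset.sum_congr rfl fun k _ ↦ key k, Finset.sum_add_distrib, Finset.sum_add_distrib,
    ← Finset.sum_mul, ← Finset.sum_mul]
  ring

end KadiriStrip

end Literature.NumberTheory.LFunctions
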